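import Literature.NumberTheory.EllipticCurves.DeShalit1987.KatzMeasureMonomialLines
import Literature.NumberTheory.EllipticCurves.IntSeriesIdentityPrinciple
import Mathlib.RingTheory.PowerSeries.Binomial
import Mathlib.NumberTheory.Padics.MahlerBasis
import HarnessLib

/-!
# `ℤ_p`-lines of the `ℤ_p²`-tower on the two-variable Katz receptacle, I: the binomial series
# `(1+T)^c` (`c ∈ ℤ_p`), the `p`-adic powers `(1+x)^c`, and the monomial line with its values
# (all PROVED; no named fact)

de Shalit 1987, II.4.17 (p. 77–78): "(51) `L_{p,𝔣}(χ, s) = L_{p,𝔣}(χκ₁^{−s})` … (52)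
`L_{p,𝔣}(χ, s) = G(χ₀; χ₁(γ₀)⁻¹u^s − 1)` … (54) `L_{p,𝔣}(χ; s₁, s₂) = L_{p,𝔣}(χ κ₁^{−s₁} κ₂^{−s₂})` … We leave
it to the reader to define `G(χ; T₁, T₂)` as a power series in two variables … and to derive the analogues
of (52) and (53)."  Along a `ℤ_p`-LINE of the `ℤ_p²`-tower presented by a generator pair `(κ₁, κ₂; γ₁, γ₂)`
(`Rubin1991.IsKatzMeasure₂`), with generator `γ` and coordinates `cᵢ = κ(γᵢ) ∈ ℤ_p`, a character `ρ` of the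
line has `ρ̂(γᵢ) = ρ̂(γ)^{cᵢ}`, so the restriction of `G` to the line is `G((1+T)^{c₁} − 1, (1+T)^{c₂} − 1)`
— the substitution `IntSeries.curveSubst` of `KatzMeasureMonomialLines.lean` along the MONOMIAL curve.
This file supplies the monomial curve and its values; the avatar identity and the frame corollary
(`IsKatzMeasure₂ ⟹ IsKatzBranch` along every sub-`ℤ_p`-line) are in `KatzMeasureMonomialLinesFrames.lean`.
Cell route `CycTangentCM`, item stmt-BirchSwinnertonDyer-22632 (the tree-level road from the one-variable
Gillard fact `thmIII212_hasUnitContent_katzBranch` to two-variable unit content).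

* §1 `IntSeries.padicIntToComplexInt : ℤ_p →+* 𝒪_{ℂ_p}`; `IntSeries.binomPow c = (1+T)^c ∈ 𝒪_{ℂ_p}⟦T⟧`
  (Mathlib `PowerSeries.binomialSeries` over the binomial ring `ℤ_[p]`; `binomPow_natCast = (1+T)^m`);
  `IntSeries.monomialLine c₁ c₂ G = curveSubst ((1+T)^{c₁} − 1) ((1+T)^{c₂} − 1) G` and its unit-content
  inequality `exists_isUnit_coeff_coeff_of_isUnit_coeff_monomialLine` (`ord` of a line `≥ m₀`).
* §2 the `p`-adic power `IntSeries.onePlusPow c x = (1+x)^c = ∑ C(c,n) xⁿ` (`‖x‖ < 1`): it is the value of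
  `binomPow c` at `x` (`hasValueAt_binomPow`), agrees with `(1+x)^m` on `ℕ`, is CONTINUOUS in `c` (Mahler
  continuity of `c ↦ C(c,n)`, uniform summability), and `‖(1+x)^c − 1‖ ≤ ‖x‖`; values of the monomial
  line (`hasValueAt_monomialLine_iff`: `= G((1+x)^{c₁} − 1, (1+x)^{c₂} − 1)`).

References: E. de Shalit, *Iwasawa theory of elliptic curves with complex multiplication* (1987),
II.4.17 (51)–(54) [deShalit1987]; N. Koblitz, *p-adic Numbers, p-adic Analysis, and Zeta-Functions*,
GTM 58, Ch. III §3–§4, Ch. IV §1 (the binomial series `(1+X)^a`, `a ∈ ℤ_p`, on the open disc) [Koblitz1984].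
-/

noncomputable section

open Filter Topology Finset
open NumberField IsDedekindDomain Field
open Literature.NumberTheory.GaloisRepresentations
open Literature.NumberTheory.EllipticCurves.GreenbergVatsal2000

namespace Literature.NumberTheory.EllipticCurves

variable {p : ℕ} [Fact p.Prime]

namespace IntSeries

/-! ### §1. `ℤ_p → 𝒪_{ℂ_p}`, the binomial series `(1+T)^c`, the monomial line -/

variable (p) in
/-- The inclusion `ℤ_p ↪ ℚ_p ↪ ℂ_p` lands in `𝒪_{ℂ_p}` (norms are preserved): `ℤ_p →+* 𝒪_{ℂ_p}`.
[cite: Koblitz1984, Ch. III §3–§4] -/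
def padicIntToComplexInt : ℤ_[p] →+* PadicComplexInt p :=
  ((algebraMap ℚ_[p] ℂ_[p]).comp PadicInt.Coe.ringHom).codRestrict (PadicComplexInt p) fun x ↦
    mem_padicComplexInt_iff.mpr (by
      change ‖((x : ℚ_[p]) : ℂ_[p])‖ ≤ 1
      rw [PadicComplex.norm_extends']
      exact x.norm_le_one)

/-- `ℤ_p → 𝒪_{ℂ_p} → ℂ_p` is `ℤ_p → ℚ_p → ℂ_p`. [cite: Koblitz1984, Ch. III §3–§4] -/
@[simp] theorem coe_padicIntToComplexInt (x : ℤ_[p]) :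
    ((padicIntToComplexInt p x : PadicComplexInt p) : ℂ_[p]) = ((x : ℚ_[p]) : ℂ_[p]) := rfl

/-- **The binomial series `(1+T)^c ∈ 𝒪_{ℂ_p}⟦T⟧`** for a `p`-adic exponent `c ∈ ℤ_p`:
`∑ₙ C(c,n) Tⁿ` with `C(c,n) ∈ ℤ_p` the Mahler-continuous binomial coefficient (`Ring.choose`,
`PadicInt.instBinomialRing`). [cite: Koblitz1984, Ch. IV §1] -/
def binomPow (c : ℤ_[p]) : PowerSeries (PadicComplexInt p) :=
  PowerSeries.map (padicIntToComplexInt p) (PowerSeries.binomialSeries ℤ_[p] c)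

/-- Coefficients of `(1+T)^c`: `[Tⁿ] = C(c,n)`. [cite: Koblitz1984, Ch. IV §1] -/
theorem coeff_binomPow (c : ℤ_[p]) (n : ℕ) :
    PowerSeries.coeff n (binomPow c) = padicIntToComplexInt p (Ring.choose c n) := by
  rw [binomPow, PowerSeries.coeff_map, PowerSeries.binomialSeries_coeff, smul_eq_mul, mul_one]

/-- `(1+T)^c` has constant term `1`. [cite: Koblitz1984, Ch. IV §1] -/
theorem constantCoeff_binomPow (c : ℤ_[p]) : PowerSeries.constantCoeff (binomPow c) = 1 := by
  rw [← PowerSeries.coeff_zero_eq_constantCoeff_apply, coeff_binomPow, Ring.choose_zero_right, map_one]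

/-- `(1+T)^c − 1` has no constant term (a curve through the origin). [cite: Koblitz1984, Ch. IV §1] -/
theorem constantCoeff_binomPow_sub_one (c : ℤ_[p]) :
    PowerSeries.constantCoeff (binomPow c - 1) = 0 := by
  rw [map_sub, constantCoeff_binomPow, map_one, sub_self]

/-- For a natural exponent the binomial series is the polynomial `(1+T)^m`. [cite: Koblitz1984, Ch. IV §1] -/
theorem binomPow_natCast (m : ℕ) : binomPow (m : ℤ_[p]) = (1 + PowerSeries.X) ^ m := by
  rw [binomPow, PowerSeries.binomialSeries_nat, map_pow, map_add, map_one, PowerSeries.map_X]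

/-- **The monomial line** `G((1+T)^{c₁} − 1, (1+T)^{c₂} − 1) ∈ 𝒪_{ℂ_p}⟦T⟧`: the restriction of
`G ∈ 𝒪_{ℂ_p}⟦T₁⟧⟦T₂⟧` to the sub-`ℤ_p`-line with coordinates `(c₁, c₂)` (de Shalit's (52) as a line of
(54)). [cite: deShalit1987, II.4.17 (51)–(54) (p. 77–78)] -/
def monomialLine (c₁ c₂ : ℤ_[p]) (G : PowerSeries (PowerSeries (PadicComplexInt p))) :
    PowerSeries (PadicComplexInt p) :=
  curveSubst (binomPow c₁ - 1) (binomPow c₂ - 1) G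

/-- **`ord` of a line is at least `m₀`** (unit currency): a unit coefficient of the monomial line in
degree `n` forces a unit coefficient `[T₁^iT₂^j]G` with `i + j ≤ n`.
[cite: deShalit1987, II.4.17 (51)–(54) (p. 77–78)] -/
theorem exists_isUnit_coeff_coeff_of_isUnit_coeff_monomialLine {c₁ c₂ : ℤ_[p]}
    {G : PowerSeries (PowerSeries (PadicComplexInt p))} {n : ℕ}
    (h : IsUnit (PowerSeries.coeff n (monomialLine c₁ c₂ G))) :
    ∃ i j : ℕ, i + j ≤ n ∧ IsUnit (PowerSeries.coeff j (PowerSeries.coeff i G)) :=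
  exists_isUnit_coeff_coeff_of_isUnit_coeff_curveSubst G (constantCoeff_binomPow_sub_one c₁)
    (constantCoeff_binomPow_sub_one c₂) h

/-- Unit content of one monomial line gives two-variable unit content.
[cite: deShalit1987, II.4.17 (51)–(54) (p. 77–78)] -/
theorem exists_isUnit_coeff_coeff_of_hasUnitContent_monomialLine {c₁ c₂ : ℤ_[p]}
    {G : PowerSeries (PowerSeries (PadicComplexInt p))} (h : HasUnitContent (monomialLine c₁ c₂ G)) :
    ∃ i j : ℕ, IsUnit (PowerSeries.coeff j (PowerSeries.coeff i G)) :=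
  exists_isUnit_coeff_coeff_of_hasUnitContent_curveSubst G (constantCoeff_binomPow_sub_one c₁)
    (constantCoeff_binomPow_sub_one c₂) h

/-! ### §2. The `p`-adic power `(1+x)^c` and the values of the monomial line -/

/-- **`(1 + x)^c = ∑ₙ C(c,n) xⁿ ∈ ℂ_p`** for `c ∈ ℤ_p` (convergent for `‖x‖ < 1`; `tsum` convention
otherwise). [cite: Koblitz1984, Ch. IV §1] -/
def onePlusPow (c : ℤ_[p]) (x : ℂ_[p]) : ℂ_[p] :=
  ∑' n : ℕ, (((Ring.choose c n : ℤ_[p]) : ℚ_[p]) : ℂ_[p]) * x ^ n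

/-- The general term of `(1+x)^c` is the evaluation term of `binomPow c`. [cite: Koblitz1984, Ch. IV §1] -/
theorem coe_coeff_binomPow_mul_pow (c : ℤ_[p]) (x : ℂ_[p]) (n : ℕ) :
    ((PowerSeries.coeff n (binomPow c) : PadicComplexInt p) : ℂ_[p]) * x ^ n =
      (((Ring.choose c n : ℤ_[p]) : ℚ_[p]) : ℂ_[p]) * x ^ n := by
  rw [coeff_binomPow, coe_padicIntToComplexInt]

/-- **`binomPow c` has value `(1+x)^c` at `x`** (`‖x‖ < 1`). [cite: Koblitz1984, Ch. IV §1] -/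
theorem hasValueAt_binomPow (c : ℤ_[p]) {x : ℂ_[p]} (hx : ‖x‖ < 1) :
    IntSeries.HasValueAt (binomPow c) x (onePlusPow c x) := by
  have h := hasValueAt_tsum (binomPow c) hx
  unfold onePlusPow
  simpa only [coe_coeff_binomPow_mul_pow] using h

/-- `binomPow c − 1` has value `(1+x)^c − 1` at `x`. [cite: Koblitz1984, Ch. IV §1] -/
theorem hasValueAt_binomPow_sub_one (c : ℤ_[p]) {x : ℂ_[p]} (hx : ‖x‖ < 1) :
    IntSeries.HasValueAt (binomPow c - 1) x (onePlusPow c x - 1) := by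
  have h1 : IntSeries.HasValueAt (1 : PowerSeries (PadicComplexInt p)) x 1 := by
    simpa using (hasValueAt_tsum (PowerSeries.X : PowerSeries (PadicComplexInt p)) hx).pow hx 0
  exact (hasValueAt_binomPow c hx).sub h1

/-- The terms of `(1+x)^c` are bounded by `‖x‖ⁿ` uniformly in `c` (`C(c,n) ∈ ℤ_p`).
[cite: Koblitz1984, Ch. IV §1] -/
theorem norm_choose_mul_pow_le (c : ℤ_[p]) (x : ℂ_[p]) (n : ℕ) :
    ‖(((Ring.choose c n : ℤ_[p]) : ℚ_[p]) : ℂ_[p]) * x ^ n‖ ≤ ‖x‖ ^ n := by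
  rw [← coe_coeff_binomPow_mul_pow]
  exact norm_coeff_mul_pow_le_one (binomPow c) x n

/-- `ℚ_p ⊆ ℂ_p` is continuous (`ℚ_p → ℚ̄_p` is a normed-algebra map, `ℚ̄_p → ℂ_p` the completion).
[cite: Koblitz1984, Ch. III §3–§4] -/
theorem continuous_coe_padic : Continuous fun x : ℚ_[p] ↦ (x : ℂ_[p]) :=
  (UniformSpace.Completion.continuous_coe (PadicAlgCl p)).comp (continuous_algebraMap ℚ_[p] (PadicAlgCl p))

/-- **`c ↦ (1+x)^c` is continuous on `ℤ_p`** (`‖x‖ < 1`): each term `C(c,n)xⁿ` is continuous in `c`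
(Mahler: `PadicInt.continuous_choose`) and the family is uniformly summable (`≤ ‖x‖ⁿ`).
[cite: Koblitz1984, Ch. IV §1] -/
theorem continuous_onePlusPow {x : ℂ_[p]} (hx : ‖x‖ < 1) : Continuous fun c : ℤ_[p] ↦ onePlusPow c x := by
  refine continuous_tsum (fun n ↦ ?_) (summable_geometric_of_lt_one (norm_nonneg x) hx)
    (fun n c ↦ norm_choose_mul_pow_le c x n)
  have hq : Continuous fun c : ℤ_[p] ↦ ((Ring.choose c n : ℤ_[p]) : ℚ_[p]) :=
    continuous_subtype_val.comp (PadicInt.continuous_choose n)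
  exact ((continuous_coe_padic (p := p)).comp hq).mul continuous_const

/-- On natural exponents `(1+x)^m` is the finite binomial sum. [cite: Koblitz1984, Ch. IV §1] -/
theorem onePlusPow_natCast (m : ℕ) (x : ℂ_[p]) : onePlusPow (m : ℤ_[p]) x = (1 + x) ^ m := by
  unfold onePlusPow
  rw [tsum_eq_sum (s := range (m + 1)) (fun n hn ↦ by
    rw [mem_range, not_lt] at hn
    rw [Ring.choose_natCast, Nat.choose_eq_zero_of_lt (by omega)]
    simp), show (1 + x) = x + 1 from add_comm 1 x, add_pow]
  refine sum_congr rfl fun n _ ↦ ?_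
  rw [Ring.choose_natCast, one_pow, mul_one, mul_comm]
  norm_cast

/-- `‖(1+x)^c − 1‖ ≤ ‖x‖` (all terms beyond the constant `1` have norm `≤ ‖x‖ⁿ ≤ ‖x‖`). In particular
`(1+x)^c` is a principal unit. [cite: Koblitz1984, Ch. IV §1] -/
theorem norm_onePlusPow_sub_one_le (c : ℤ_[p]) {x : ℂ_[p]} (hx : ‖x‖ < 1) :
    ‖onePlusPow c x - 1‖ ≤ ‖x‖ :=
  (norm_le_of_hasValueAt_of_constantCoeff_eq_zero (constantCoeff_binomPow_sub_one c) hx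
    (hasValueAt_binomPow_sub_one c hx))

/-- **Values of the monomial line**: for `‖x‖ < 1`, `monomialLine c₁ c₂ G` has value `v` at `x` iff `G`
has value `v` at `((1+x)^{c₁} − 1, (1+x)^{c₂} − 1)`. [cite: deShalit1987, II.4.17 (51)–(54) (p. 77–78)] -/
theorem hasValueAt_monomialLine_iff (c₁ c₂ : ℤ_[p]) (G : PowerSeries (PowerSeries (PadicComplexInt p)))
    {x : ℂ_[p]} (hx : ‖x‖ < 1) (v : ℂ_[p]) :
    IntSeries.HasValueAt (monomialLine c₁ c₂ G) x v ↔
      IntSeries.HasValueAt₂ G (onePlusPow c₁ x - 1) (onePlusPow c₂ x - 1) v :=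
  hasValueAt_curveSubst_iff G (constantCoeff_binomPow_sub_one c₁) (constantCoeff_binomPow_sub_one c₂) hx
    (hasValueAt_binomPow_sub_one c₁ hx) (hasValueAt_binomPow_sub_one c₂ hx) v

end IntSeries

end Literature.NumberTheory.EllipticCurves
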